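import Summits.AtomisticToContinuum.Crystallization.Theorems.ThreeConeCertificateExactCertificateAllTemplatesKernel
import Literature.MathematicalPhysics.StatisticalMechanics.LennardJonesClusters
import HarnessLib

/-!
# Crux `ExactCertificate` (stmt-AtomisticToContinuum-11959), line `closure-makes-nogap-exact`, skeleton X (`AllTemplates`), part II:
# the slack cone is active beyond every radius at EVERY template (registered assembly stub `stub_allTemplatesAssembly`)

Support file for the crux `ThreeConeCertificate.ExactCertificate`; nothing here closes the 3-D crux (`NoGap ∧ KeplerBound`,
`KeplerBound` = item 11961 ↔ 0627 open).  Skeleton IX (`…FarEqual.lean`) refuted the census's S⁺₂ ("`U ≡ 0` beyond a radius") for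
commensurate templates; with the window engine of part I the template caveat disappears:

* `allTemplates_farSlackActive` — for EVERY exact three-cone certificate `(P, ρ, c, g, U, f)` of the crux (six clauses verbatim) with
  measurable Bochner kernel `f`, at ANY periodic template `P`, and every `ρ′`: `∃ r ≥ ρ′, U r ≠ 0`;
* `stub_allTemplatesAssembly` (registered) = the deciding statement `AllTemplates` of skeleton X: the conjunction of part I's
  `allTemplates_noInvisibleKernel` and `allTemplates_farSlackActive`.

The only remaining qualification in the whole chain (skeletons VIII–X) is measurability of `f` in the certificate half.  All `[folklore]`.
-/

noncomputable section

namespace Summit.AtomisticToContinuum.Crystallization.Theorems.ThreeConeCertificateExactCertificate.AllTemplates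

open Literature.MathematicalPhysics.StatisticalMechanics MeasureTheory Set Filter Topology
open Summit.AtomisticToContinuum.Crystallization.Theorems.ChargedEnergyGapNegative (E3)
open Summit.AtomisticToContinuum.Crystallization.Theorems.ExactCertificateNegative (IsSplit)
open Summit.AtomisticToContinuum.Crystallization.Theorems.BraggSlacknessRigidityStrictCertificate
  (structureFactor_mul_fourier_eq_zero)
open Summit.AtomisticToContinuum.Crystallization.Theorems.ThreeConeCertificateExactCertificate.Invisibility
open Summit.AtomisticToContinuum.Crystallization.Theorems.ThreeConeCertificateExactCertificate.FarEqual
open scoped BigOperators FourierTransform RealInnerProductSpace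

/-- **At EVERY template: the slack cone of an exact certificate with measurable kernel is active beyond every radius**
(skeleton IX without the commensurability caveat). [folklore] -/
theorem allTemplates_farSlackActive : ∀ (P : PeriodicConfiguration 3) (ρ c : ℝ) (g U f : ℝ → ℝ),
    (∀ r : ℝ, 0 < r → lennardJones r = g r + U r + f r) → (∀ r : ℝ, 0 < r → 0 ≤ U r) →
    (∀ r : ℝ, ρ ≤ r → g r = 0) →
    (∀ (n : ℕ) (y : Fin n → EuclideanSpace ℝ (Fin 3)) (w : Fin n → ℝ),
      0 ≤ ∑ i, ∑ j, w i * w j * f (dist (y i) (y j))) →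
    (∀ (N : ℕ) (x : Fin N → EuclideanSpace ℝ (Fin 3)), Function.Injective x →
      -(c * (N : ℝ)) ≤ interactionEnergy g x) →
    c + f 0 / 2 = -(P.energyPerParticle lennardJones) →
    Measurable f → ∀ ρ' : ℝ, ∃ r : ℝ, ρ' ≤ r ∧ U r ≠ 0 := by
  intro P ρ c g U f h1 h2 h3 h4 h5 hval hfm ρ'
  by_contra hno
  have hU0 : ∀ r : ℝ, ρ' ≤ r → U r = 0 := fun r hr => by
    by_contra h
    exact hno ⟨r, hr, h⟩
  have hs : IsSplit ρ c g U f := ⟨h1, h2, h3, h4, h5⟩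
  -- the radius beyond which `f = V`
  set ρ'' : ℝ := max (max ρ ρ') 1 with hρ''
  have hρ''1 : 1 ≤ ρ'' := le_max_right _ _
  have hρ''pos : 0 < ρ'' := by linarith
  have hρρ'' : ρ ≤ ρ'' := (le_max_left _ _).trans (le_max_left _ _)
  have hρ'ρ'' : ρ' ≤ ρ'' := (le_max_right _ _).trans (le_max_left _ _)
  have hfV : ∀ r : ℝ, ρ'' ≤ r → f r = lennardJones r := by
    intro r hr
    rw [hs.f_eq_tail (hρρ''.trans hr) (hρ''pos.trans_le hr), hU0 r (hρ'ρ''.trans hr), sub_zero]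
  -- the kernel on `ℝ³` and its integrability
  set F : E3 → ℂ := fun v => (f ‖v‖ : ℂ) with hFdef
  have hFmeas : AEStronglyMeasurable F volume :=
    (Complex.continuous_ofReal.measurable.comp (hfm.comp measurable_norm)).aestronglyMeasurable
  set C : ℝ := max (f 0 * (1 + ρ'') ^ 6) 16 with hC
  have hbound : ∀ v : E3, ‖F v‖ ≤ C * (1 + ‖v‖) ^ (-(6 : ℝ)) := by
    intro v
    rw [Real.rpow_neg (by positivity), show (6 : ℝ) = ((6 : ℕ) : ℝ) by norm_num, Real.rpow_natCast,
      ← div_eq_mul_inv, le_div_iff₀ (by positivity)]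
    simp only [hFdef, Complex.norm_real, Real.norm_eq_abs]
    by_cases hv : ‖v‖ ≤ ρ''
    · calc |f ‖v‖| * (1 + ‖v‖) ^ 6 ≤ f 0 * (1 + ρ'') ^ 6 := by
            gcongr
            · exact hs.f_zero_nonneg
            · exact hs.abs_f_le (norm_nonneg _)
        _ ≤ C := le_max_left _ _
    · rw [not_le] at hv
      rw [hfV ‖v‖ hv.le]
      exact (abs_lennardJones_mul_le (hρ''1.trans hv.le)).trans (le_max_right _ _)
  have hFi : Integrable F := by
    refine ((integrable_one_add_norm (E := E3) (μ := volume) (r := 6) ?_).const_mul C).mono' hFmeas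
      (ae_of_all _ hbound)
    rw [finrank_euclideanSpace_fin]; norm_num
  -- Bragg-peak vanishing at dual vectors; the structure factor is non-zero on a window-dense set `D` of a dual plane (X2)
  obtain ⟨k₁, k₂, hli, hk₁, hk₂⟩ := exists_dualVectors P
  set Sf : ℤ → ℤ → ℂ := fun n j =>
    ∑ x ∈ P.motif, Complex.exp (↑(-2 * Real.pi * ⟪x, (n : ℝ) • k₁ + (j : ℝ) • k₂⟫) * Complex.I) with hSf
  set D : Set (ℤ × ℤ) := {p | Sf p.1 p.2 ≠ 0} with hD
  have hwpos : 0 < P.motif.card := Finset.card_pos.2 P.motif_nonempty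
  have hDwin : ∀ j₀ : ℤ, ∃ j : ℤ, j₀ ≤ j ∧ j < j₀ + P.motif.card ∧
      ∀ n₀ : ℤ, ∃ n : ℤ, n₀ ≤ n ∧ n < n₀ + P.motif.card ∧ (n, j) ∈ D :=
    stub_structureFactorWindows stub_expSumWindow P k₁ k₂
  have hzF : ∀ n j : ℤ, (n, j) ∈ D → 𝓕 F ((n : ℝ) • k₁ + (j : ℝ) • k₂) = 0 := by
    intro n j hnj
    have hkdual : ∀ g' ∈ P.lattice, ∃ m : ℤ, ⟪(n : ℝ) • k₁ + (j : ℝ) • k₂, g'⟫ = (m : ℝ) := by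
      intro g' hg'
      obtain ⟨p₁, hp₁⟩ := hk₁ g' hg'
      obtain ⟨p₂, hp₂⟩ := hk₂ g' hg'
      refine ⟨n * p₁ + j * p₂, ?_⟩
      rw [inner_add_left, real_inner_smul_left, real_inner_smul_left, hp₁, hp₂]
      push_cast
      ring
    have h := structureFactor_mul_fourier_eq_zero hs hval.le hFi hkdual
    exact (mul_eq_zero.1 h).resolve_left hnj
  -- the explicit tail model `G = V_LJ(max(‖·‖, ρ″))` and the compactly supported `H = F − G`
  set W : ℕ → E3 → ℂ := fun m v => ((((max (‖v‖ ^ 2) (ρ'' ^ 2))⁻¹) ^ m : ℝ) : ℂ) with hWdef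
  set G : E3 → ℂ := fun v => (1 / 12 : ℂ) * W 6 v - (1 / 6 : ℂ) * W 3 v with hGdef
  have hGF : ∀ v : E3, ρ'' ≤ ‖v‖ → G v = F v := by
    intro v hv
    have hv0 : 0 < ‖v‖ := hρ''pos.trans_le hv
    have hmax : max (‖v‖ ^ 2) (ρ'' ^ 2) = ‖v‖ ^ 2 :=
      max_eq_left (pow_le_pow_left₀ hρ''pos.le hv 2)
    have e6 : ((‖v‖ ^ 2)⁻¹) ^ 6 = (‖v‖⁻¹) ^ 12 := by rw [← inv_pow, ← pow_mul]
    have e3 : ((‖v‖ ^ 2)⁻¹) ^ 3 = (‖v‖⁻¹) ^ 6 := by rw [← inv_pow, ← pow_mul]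
    simp only [hGdef, hWdef, hFdef, hmax, hfV ‖v‖ hv, lennardJones, e6, e3]
    push_cast
    ring
  set H : E3 → ℂ := fun v => F v - G v with hHdef
  have hHsupp : ∀ v : E3, ρ'' < ‖v‖ → H v = 0 := fun v hv => by
    simp only [hHdef, hGF v hv.le, sub_self]
  have hW6 : Integrable (W 6) := integrable_maxPow' hρ''pos (by norm_num)
  have hW3 : Integrable (W 3) := integrable_maxPow' hρ''pos le_rfl
  have hGi : Integrable G := (hW6.const_mul _).sub (hW3.const_mul _)
  have hHi : Integrable H := hFi.sub hGi
  -- the slices: `Φ_H` (skeleton VIII) and `Θ₃`, `Θ₆` (stub F7)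
  obtain ⟨ΦH, hΦHd, ⟨B₁, τ₁, hB₁⟩, hΦHF⟩ := stub_sliceEntire H ρ'' hHi hHsupp
  have h7 := stub_sliceMaxPow stub_fourierEntireReal stub_sliceBridge stub_planeIntegralMaxPow
    (stub_tailCosTransform (stub_remEntire stub_cosTaylorBounds) (stub_remScaling stub_cosTaylorBounds))
  obtain ⟨Θ₃, hΘ₃d, ⟨B₃, τ₃, hB₃⟩, hΘ₃F⟩ := h7 3 ρ'' le_rfl hρ''pos
  obtain ⟨Θ₆, hΘ₆d, ⟨B₆, τ₆, hB₆⟩, hΘ₆F⟩ := h7 6 ρ'' (by norm_num) hρ''pos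
  set Ξ : ℂ → ℂ := fun z => ΦH z + ((1 / 12 : ℂ) * Θ₆ z - (1 / 6 : ℂ) * Θ₃ z) with hΞdef
  have hΞd : Differentiable ℂ Ξ := hΦHd.add ((hΘ₆d.const_mul _).sub (hΘ₃d.const_mul _))
  set T : ℝ := |τ₁| + |τ₆| + |τ₃| with hT
  have hexp : ∀ (τ : ℝ) (z : ℂ), |τ| ≤ T → Real.exp (τ * ‖z‖) ≤ Real.exp (T * ‖z‖) := fun τ z hτ =>
    Real.exp_le_exp.2 (mul_le_mul_of_nonneg_right ((le_abs_self τ).trans hτ) (norm_nonneg z))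
  have hΞB : ∀ z : ℂ, ‖Ξ z‖ ≤ (|B₁| + |B₆| + |B₃|) * Real.exp (T * ‖z‖) := by
    intro z
    have hτ₁ : |τ₁| ≤ T := by rw [hT]; linarith [abs_nonneg τ₆, abs_nonneg τ₃]
    have hτ₆ : |τ₆| ≤ T := by rw [hT]; linarith [abs_nonneg τ₁, abs_nonneg τ₃]
    have hτ₃ : |τ₃| ≤ T := by rw [hT]; linarith [abs_nonneg τ₁, abs_nonneg τ₆]
    have g₁ : ‖ΦH z‖ ≤ |B₁| * Real.exp (T * ‖z‖) :=
      (hB₁ z).trans ((mul_le_mul_of_nonneg_right (le_abs_self _) (Real.exp_pos _).le).trans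
        (mul_le_mul_of_nonneg_left (hexp τ₁ z hτ₁) (abs_nonneg _)))
    have g₆ : ‖Θ₆ z‖ ≤ |B₆| * Real.exp (T * ‖z‖) :=
      (hB₆ z).trans ((mul_le_mul_of_nonneg_right (le_abs_self _) (Real.exp_pos _).le).trans
        (mul_le_mul_of_nonneg_left (hexp τ₆ z hτ₆) (abs_nonneg _)))
    have g₃ : ‖Θ₃ z‖ ≤ |B₃| * Real.exp (T * ‖z‖) :=
      (hB₃ z).trans ((mul_le_mul_of_nonneg_right (le_abs_self _) (Real.exp_pos _).le).trans
        (mul_le_mul_of_nonneg_left (hexp τ₃ z hτ₃) (abs_nonneg _)))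
    have n₆ : ‖(1 / 12 : ℂ) * Θ₆ z‖ ≤ ‖Θ₆ z‖ := by
      rw [norm_mul]; exact mul_le_of_le_one_left (norm_nonneg _) (by norm_num)
    have n₃ : ‖(1 / 6 : ℂ) * Θ₃ z‖ ≤ ‖Θ₃ z‖ := by
      rw [norm_mul]; exact mul_le_of_le_one_left (norm_nonneg _) (by norm_num)
    calc ‖Ξ z‖ ≤ ‖ΦH z‖ + (‖(1 / 12 : ℂ) * Θ₆ z‖ + ‖(1 / 6 : ℂ) * Θ₃ z‖) :=
          (norm_add_le _ _).trans (add_le_add le_rfl (norm_sub_le _ _))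
      _ ≤ |B₁| * Real.exp (T * ‖z‖) + (|B₆| * Real.exp (T * ‖z‖) + |B₃| * Real.exp (T * ‖z‖)) := by
          gcongr
          · exact n₆.trans g₆
          · exact n₃.trans g₃
      _ = (|B₁| + |B₆| + |B₃|) * Real.exp (T * ‖z‖) := by ring
  -- linearity: `𝓕F = 𝓕H + (1/12)𝓕W₆ − (1/6)𝓕W₃`
  have hlin : ∀ ξ : E3, 𝓕 F ξ = 𝓕 H ξ + ((1 / 12 : ℂ) * 𝓕 (W 6) ξ - (1 / 6 : ℂ) * 𝓕 (W 3) ξ) := by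
    intro ξ
    set χ : E3 → ℂ := fun v => Complex.exp (↑(-2 * Real.pi * ⟪v, ξ⟫) * Complex.I) with hχ
    have hχn : ∀ v, ‖χ v‖ = 1 := fun v => Complex.norm_exp_ofReal_mul_I _
    have hχm : AEStronglyMeasurable χ volume := by
      refine Continuous.aestronglyMeasurable ?_
      rw [hχ]; fun_prop
    have hint : ∀ {K : E3 → ℂ}, Integrable K → Integrable fun v => χ v * K v := fun hK =>
      hK.bdd_mul (c := 1) hχm (ae_of_all _ fun v => (hχn v).le)
    simp only [Real.fourier_eq', smul_eq_mul]
    have eF : ∀ v, χ v * F v = χ v * H v + ((1 / 12 : ℂ) * (χ v * W 6 v) - (1 / 6 : ℂ) * (χ v * W 3 v)) := by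
      intro v; simp only [hHdef, hGdef]; ring
    rw [show (fun v => χ v * F v) = fun v => χ v * H v + ((1 / 12 : ℂ) * (χ v * W 6 v) - (1 / 6 : ℂ) * (χ v * W 3 v))
      from funext eF]
    have i6 : Integrable (fun v => (1 / 12 : ℂ) * (χ v * W 6 v)) := (hint hW6).const_mul _
    have i3 : Integrable (fun v => (1 / 6 : ℂ) * (χ v * W 3 v)) := (hint hW3).const_mul _
    have i63 : Integrable (fun v => (1 / 12 : ℂ) * (χ v * W 6 v) - (1 / 6 : ℂ) * (χ v * W 3 v)) := i6.sub i3
    rw [integral_add (hint hHi) i63, integral_sub i6 i3, integral_const_mul, integral_const_mul]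
  have hΞF : ∀ s : ℝ, 0 < s → Ξ (s : ℂ) = 𝓕 F (s • EuclideanSpace.single (0 : Fin 3) (1 : ℝ)) := by
    intro s hs0
    rw [hlin, ← hΦHF s, ← hΘ₆F s hs0, ← hΘ₃F s hs0]
  -- zeros of `Ξ` at the norms of the dilated dual plane
  have hnorm : ∀ {s : ℝ}, 0 ≤ s → ‖s • (EuclideanSpace.single (0 : Fin 3) (1 : ℝ) : E3)‖ = s := by
    intro s hs0
    rw [norm_smul, Real.norm_eq_abs, abs_of_nonneg hs0]
    simp
  have hrad := stub_fourierRadial (fun r : ℝ => (f r : ℂ))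
  have hzΞ : ∀ n j : ℤ, (n, j) ∈ D → (n, j) ≠ (0, 0) →
      Ξ (‖(n : ℝ) • k₁ + (j : ℝ) • k₂‖ : ℂ) = 0 := by
    intro n j hD' hnj
    set k : E3 := (n : ℝ) • k₁ + (j : ℝ) • k₂ with hkdef
    have hk0 : k ≠ 0 := by
      intro hk
      rw [LinearIndependent.pair_iff] at hli
      have h := hli n j (by rw [hkdef] at hk; exact hk)
      exact hnj (by rw [Prod.mk.injEq]; exact ⟨by exact_mod_cast h.1, by exact_mod_cast h.2⟩)
    have hkpos : 0 < ‖k‖ := norm_pos_iff.2 hk0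
    rw [hΞF ‖k‖ hkpos, hrad _ k (hnorm hkpos.le)]
    exact hzF n j hD'
  have hΞ0 := entire_eq_zero_of_vanish_on_latticeNorms_window Ξ hΞd hΞB hli D P.motif.card hwpos hDwin hzΞ
  -- `𝓕F ≡ 0`
  have hF0' : ∀ ξ : E3, ξ ≠ 0 → 𝓕 F ξ = 0 := by
    intro ξ hξ
    have hξpos : 0 < ‖ξ‖ := norm_pos_iff.2 hξ
    rw [hrad ξ (‖ξ‖ • EuclideanSpace.single (0 : Fin 3) (1 : ℝ)) (by rw [hnorm hξpos.le]), ← hΞF ‖ξ‖ hξpos]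
    exact hΞ0 _
  have hcontF : Continuous (𝓕 F) :=
    VectorFourier.fourierIntegral_continuous Real.continuous_fourierChar continuous_inner hFi
  have hF0 : 𝓕 F = 0 := by
    have hclosed : IsClosed {ξ : E3 | 𝓕 F ξ = 0} := isClosed_eq hcontF continuous_const
    have hsub : ({(0 : E3)}ᶜ : Set E3) ⊆ {ξ : E3 | 𝓕 F ξ = 0} := fun ξ hξ => hF0' ξ hξ
    have hdense : Dense ({(0 : E3)}ᶜ : Set E3) := dense_compl_singleton 0
    have huniv : (Set.univ : Set E3) ⊆ {ξ : E3 | 𝓕 F ξ = 0} := by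
      rw [← hdense.closure_eq]
      exact hclosed.closure_subset_iff.2 hsub
    funext ξ
    exact huniv (Set.mem_univ ξ)
  -- Fourier inversion at a continuity point of `F` beyond `ρ″`
  set v₀ : E3 := (ρ'' + 1) • EuclideanSpace.single (0 : Fin 3) (1 : ℝ) with hv₀
  have hv₀n : ‖v₀‖ = ρ'' + 1 := hnorm (by linarith)
  have hopen : IsOpen {v : E3 | ρ'' < ‖v‖} := isOpen_lt continuous_const continuous_norm
  have hv₀mem : v₀ ∈ {v : E3 | ρ'' < ‖v‖} := by
    show ρ'' < ‖v₀‖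
    rw [hv₀n]; linarith
  have hLJcont : ContinuousOn (fun v : E3 => ((lennardJones ‖v‖ : ℝ) : ℂ)) {v : E3 | ρ'' < ‖v‖} := by
    refine Complex.continuous_ofReal.comp_continuousOn ?_
    have hne : ∀ v ∈ {v : E3 | ρ'' < ‖v‖}, ‖v‖ ≠ 0 := fun v hv => (hρ''pos.trans hv).ne'
    unfold lennardJones
    refine ContinuousOn.sub (ContinuousOn.mul continuousOn_const ((continuous_norm.continuousOn.inv₀ hne).pow 12))
      (ContinuousOn.mul continuousOn_const ((continuous_norm.continuousOn.inv₀ hne).pow 6))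
  have hFeq : Set.EqOn F (fun v : E3 => ((lennardJones ‖v‖ : ℝ) : ℂ)) {v : E3 | ρ'' < ‖v‖} := by
    intro v hv
    simp only [hFdef, hfV ‖v‖ (le_of_lt hv)]
  have hFcontAt : ContinuousAt F v₀ := by
    have hc1 : ContinuousAt (fun v : E3 => ((lennardJones ‖v‖ : ℝ) : ℂ)) v₀ :=
      (hLJcont v₀ hv₀mem).continuousAt (hopen.mem_nhds hv₀mem)
    exact hc1.congr_of_eventuallyEq (Filter.eventuallyEq_of_mem (hopen.mem_nhds hv₀mem) hFeq)
  have hinv := hFi.fourierInv_fourier_eq (by rw [hF0]; exact integrable_zero _ _ _) hFcontAt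
  rw [hF0, Real.fourierInv_eq'] at hinv
  simp only [Pi.zero_apply, smul_zero, integral_zero] at hinv
  -- `F v₀ = V_LJ(ρ″ + 1) < 0`, contradiction
  have hFv₀ : F v₀ = (lennardJones (ρ'' + 1) : ℂ) := by
    simp only [hFdef, hv₀n, hfV (ρ'' + 1) (by linarith)]
  have hneg : lennardJones (ρ'' + 1) < 0 := lennardJones_neg (by linarith)
  have : (lennardJones (ρ'' + 1) : ℂ) = 0 := by rw [← hFv₀, ← hinv]
  exact hneg.ne (by exact_mod_cast this)


/-- **Registered assembly stub `stub_allTemplatesAssembly` = the deciding statement `AllTemplates` of skeleton X.** [folklore] -/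
theorem stub_allTemplatesAssembly :
  (∀ (P : PeriodicConfiguration 3) (α : ℝ → ℝ) (L : ℝ), Continuous α → (∀ r : ℝ, L ≤ r → α r = 0) →
      (∀ w : EuclideanSpace ℝ (Fin 3),
        HasSum (fun y : P.points => α (dist w (y : EuclideanSpace ℝ (Fin 3)))) 0) →
      ∀ r : ℝ, 0 ≤ r → α r = 0) ∧
  (∀ (P : PeriodicConfiguration 3) (ρ c : ℝ) (g U f : ℝ → ℝ),
    (∀ r : ℝ, 0 < r → lennardJones r = g r + U r + f r) → (∀ r : ℝ, 0 < r → 0 ≤ U r) →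
    (∀ r : ℝ, ρ ≤ r → g r = 0) →
    (∀ (n : ℕ) (y : Fin n → EuclideanSpace ℝ (Fin 3)) (w : Fin n → ℝ),
      0 ≤ ∑ i, ∑ j, w i * w j * f (dist (y i) (y j))) →
    (∀ (N : ℕ) (x : Fin N → EuclideanSpace ℝ (Fin 3)), Function.Injective x →
      -(c * (N : ℝ)) ≤ interactionEnergy g x) →
    c + f 0 / 2 = -(P.energyPerParticle lennardJones) →
    Measurable f → ∀ ρ' : ℝ, ∃ r : ℝ, ρ' ≤ r ∧ U r ≠ 0)
    :=
  ⟨fun P α L hα hL hinv => allTemplates_noInvisibleKernel P α L hα hL hinv, allTemplates_farSlackActive⟩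

end Summit.AtomisticToContinuum.Crystallization.Theorems.ThreeConeCertificateExactCertificate.AllTemplates

end
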